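import Literature.MathematicalPhysics.QuantumFieldTheory.Balaban1983to89.B15LeafKnitMassSel
import Literature.MathematicalPhysics.QuantumFieldTheory.Balaban1983to89.Node00.RStepProvisosIntOfRecord
import Literature.MathematicalPhysics.QuantumFieldTheory.Balaban1983to89.Node00.Record13Carriers

/-!
# BalabanUVNodes ∕ N12 — THE [IV] LEAF KNIT IN THE INTEGRABLE CURRENCY and THE [IV] LEAF AT NODE 00's STAGE-13 BUNDLE OF RECORD `WOfRecord₁₃ θ λ P`
# (Track A, DAG node N12 = [B15, Balaban1989LargeFieldI] CMP **122** (1989) 175–202; cluster K1‴ `StabilityBAtRecordR13e` = stmt-QuantumFields-19910 (rev 16,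
# `stub_nodes13`'s row `h12`); seat `pub-ymgap-dag-n12-d` g6 (R134 s2 «knit at the record», HANDOFF trigger t12 = rev 16 ∕ Record 13), 2026-08-27; count-neutral, NOT a discharge)

HONEST FRAMING.  Count-neutral kernel BOOKKEEPING BY NAME plus elementary Bochner ∕ Tonelli facts over def-R's integrable-currency (0.3)–(0.4) ∕ (1.102) theorems
(`Node00/RStepProvisosIntOfRecord`: `integral_ropReal_eq_int`, `exists_measurable_nonneg_modification`, `lintegral_lmarginal_ofReal_eq`, `fibreIntegral_congr_ae`),
n12-a ∕ n12-e's knit (`B15LeafKnit`, `B15LeafKnitRepr`, `B15LeafKnitMassSel`) and n10-d's Stage-13 carrier module (`Node00/Record13Carriers`: `WOfRecord₁₃`).  Nothing of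
Bałaban's is asserted; Proposition 1 (1.78), (1.80), (1.89), the denominator-mass display and the (1.100) pin equation are DISPLAYED hypotheses; `Provisos₁₃` is displayed
(K0‴); N12 NOT discharged.

WHY THIS FILE.  Every landed N12 leaf at NODE 00's bundle of record (this seat g2–g5, dag-n12-e modules 2–13, node00-def g30) is keyed on `WOfRecord₁₀ F N θ₉ λ P` with
`θ₉ := Θ.toStage9Params`; at Records ₁₁ ∕ ₁₂ that is the bundle of record (`WOfRecord₁₂ = WOfRecord₁₀ ∘ toStage9Params`, `rfl`).  At def-T's RECORD 13
(`Node00/Record13` v1.1 p488788) it is NOT: n10-d's `WOfRecord₁₃ θ λ P := WOfRepr (reprTOfRecord₁₃ θ P k) (θ.ppSel P (gOfRecord₁₃ θ P) (k+1)) (fibOfSeq … (gOfRecord₁₃ θ P) (k+1)) …`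
(`Node00/Record13Carriers`, dag-n08-c LOCATED-CARRIERS-13 ∕ dag-lead WORDS-130) reads the ₁₃ HISTORIES `gOfRecord₁₃ = genSeq β₁₃ g₀` and `EOfRecord₁₃` (β at `TcanOfRecord` and the
(2.9) species — different objects from β₁₀; Record13 (μ): no ₁₀∕₁₂ ⇒ ₁₃ comparison), so no ₁₂ leaf transfers by `rfl`.  Second, `Provisos₁₃.rstep` is def-R's INTEGRABLE
form `RepData.ProvisosInt` (integrable pieces ∧ a.e. `≥ 0` ∧ the a.e. support clause — [IV] p.176 «the densities are positive, and the integration domains … nonempty»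
read almost everywhere), whereas every landed [IV] leaf knit (`b15Leaf_knit_logExp_of_massSel`, `b15Leaf_WOfRepr_of_massSel`, `b15Leaf_WOfTower9_of_massSel`,
`terms_of_provisos₁₀`) consumes the SUPPORT-form strength `hm ∕ h0 ∕ hC` (measurable, everywhere `≥ 0`, uniformly bounded) that `Provisos₁₃` does not supply.
HENCE §1: the [IV] leaf knit RE-PROVED IN THE INTEGRABLE CURRENCY — (0.4) `Normalization04`, the positivity of the (0.5)-sums on the occurring regions, (0.6) `ExpForm06`
and (1.102) at the 𝐑-step's own (1.100)-reading from INTEGRABLE a.e.-non-negative pieces (the one new measure-theoretic line is `integral_fibreIntegral_int`: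
`∫dV ∫dV⌈_{Z′} f = ∫dV f` for an integrable a.e.-non-negative density, via a measurable non-negative modification); §2: the leaf at `WOfRecord₁₃ θ λ P` from `Provisos₁₃`
(its `rstep` field through def-R's `rfl` bridge `toRepData_towerRepOfRecord_eq`), `kSel P < P.K`, the (1.100) PIN EQUATION `hpin` DISPLAYED (dag-n12-e's pin
`ResidW.pinRPrime θ₉` reads `repTOfRecord9 … (EOfRecord₁₀ θ₉) … (gOfRecord₁₀ θ₉ P)`, a different tower than `reprTOfRecord₁₃` — a ₁₃-keyed ∕ history-generic re-key of the
pins is the n12-e lineage's ∕ the definition lane's one small module; LOCATED-3 on the bus), the denominator-mass display `hmassSel`, the fibre witness `hfib`, and EXACTLY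
Proposition 1 (1.78), (1.80), (1.89) at the layer's letters; the `rBasicStep` leaf of n10-d's four-pin Stage-13 view `θ.view₁₃B10YZW Mstar ops ζ λ` follows by his `Iff`.
WHAT N12 THEN COSTS at the Stage-13 bundle of record (typing strength, NOT a second gap): `Provisos₁₃` (K0‴), the denominator-mass display (NODE 00's measure-theoretic
residue of p.176 ll.14–16; on a live re-pin it reads «every LIVE pre-𝐑 term has positive mass» and `hfib` is free — sequel `…N12AtRecord13LiveLine`), the (1.100) pin
equation (definition lane), Prop. 1 at `λ.LF P` (dag-n12-c), (1.80) + (1.89) at `λ.D189 P` (dag-n12-e; at ₁₃ their letters want thresholds at `gOfRecord₁₃`), and for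
runs with `K ≤ kSel P` the Int provisos of the knit datum displayed.  One finite four-torus programme at fixed `ε`; nothing continuum ∕ ℝ⁴ ∕ OS ∕ mass gap ∕ Clay.
0 `sorry`, 0 `def`, standard axioms.  Filed `--supports` K1‴ (stmt-QuantumFields-19910) `--as helper`.
Sources: [Balaban1989LargeFieldI] (0.2)–(0.6) pp.176–177, Prop. 1 (1.78) p.194, (1.80) p.195, (1.89) p.198, (1.99)–(1.102) pp.200–201;
[Balaban1988Convergent] (2.18) p.257, (3.25) p.270; [Balaban1989LargeFieldII] Thm 1 + (0.1) pp.355–356.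
-/

noncomputable section

open scoped BigOperators ENNReal
open MeasureTheory

namespace Summit.QuantumFields.YangMills.BalabanUVNodes.N12LeafIntAtRecord13

open Literature.MathematicalPhysics.QuantumFieldTheory.Balaban1983to89
open Literature.MathematicalPhysics.QuantumFieldTheory.Balaban1983to89.T4Continuum (T4Family)
open Literature.MathematicalPhysics.QuantumFieldTheory.Balaban1983to89.DagBinding (PrintedCarriers15 B15Leaf)
open Literature.MathematicalPhysics.QuantumFieldTheory.Balaban1983to89.Node00
open B15 (RData Rop Normalization04 ExpForm06 Prop1Printed Ineq180)
open B15.BasicStep (fibreIntegral RopReal Claim189 exists_measurable_nonneg_modification fibreIntegral_congr_ae integral_ropReal_eq_int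
  lintegral_lmarginal_ofReal_eq)
open B15Eq06Resum (quot03 quotSum)
open B15Sect1Statements (RPrimeData rPrime1100 Normalization1102)
open B15Claim189Assembly (Setting189 new189 chiPP dom)
open B8Eq17ClassAkV1 (plaqsOf)
open B15RopTotal (RepData)
open B15LeafKnit (knitRData KnitData knitW15)
open B15LeafKnitRepr (knitOfRepr WOfRepr)
open B15RPrime1100OfRep (rPrimeDataOfSel rPrime1100_rPrimeDataOfSel)

/-! ## §1 THE [IV] LEAF KNIT IN THE INTEGRABLE CURRENCY (generic: any lattice `P`, level `k`, compact group `G`, finite region type `R`) -/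

section Generic

variable {P : Params} {k : ℕ} {G : Type} [GaugeGroup G] [MeasurableSpace G] [HaarData G] [DecidableEq (PBond P k)]

/-- **`∫dV ∫dV⌈_{Z′} f = ∫dV f` FOR AN INTEGRABLE, A.E.-NON-NEGATIVE DENSITY** (the (0.4)-type tower identity WITHOUT measurability ∕ everywhere-positivity ∕ a uniform
bound): pass to def-R's measurable non-negative modification `f′` (`exists_measurable_nonneg_modification`; the restricted fibre integrals agree a.e., `fibreIntegral_congr_ae`),
then Tonelli over the normalised Haar fibres (`lintegral_lmarginal_ofReal_eq`) and `integral_toReal`. [cite: Balaban1989LargeFieldI, (0.4) p.176 (measure-theoretic bookkeeping, a.e. reading of p.176 ll.14–16)] -/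
theorem integral_fibreIntegral_int (s : Finset (PBond P k)) {f : Density P k G} (hfi : Integrable f (fieldMeasure P k G))
    (h0 : ∀ᵐ V ∂(fieldMeasure P k G), 0 ≤ f V) :
    ∫ V, fibreIntegral s f V ∂(fieldMeasure P k G) = ∫ V, f V ∂(fieldMeasure P k G) := by
  obtain ⟨f', hm', hae, h0'⟩ := exists_measurable_nonneg_modification hfi.1 h0
  rw [integral_congr_ae (fibreIntegral_congr_ae s hae), integral_congr_ae hae]
  have hfi' : Integrable f' (fieldMeasure P k G) := hfi.congr hae
  have hLm : Measurable fun V : GaugeField P k G =>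
      (∫⋯∫⁻_s, (fun U => ENNReal.ofReal (f' U)) ∂(fun _ : PBond P k => (HaarData.haar : Measure G))) V :=
    (ENNReal.measurable_ofReal.comp hm').lmarginal (fun _ : PBond P k => (HaarData.haar : Measure G))
  have hlin := lintegral_lmarginal_ofReal_eq s hm'
  have hfin : ∫⁻ V, ENNReal.ofReal (f' V) ∂(fieldMeasure P k G) ≠ ∞ :=
    ((hasFiniteIntegral_iff_ofReal (Filter.Eventually.of_forall h0')).1 hfi'.hasFiniteIntegral).ne
  rw [← hlin] at hfin
  have hlt : ∀ᵐ V ∂(fieldMeasure P k G),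
      (∫⋯∫⁻_s, (fun U => ENNReal.ofReal (f' U)) ∂(fun _ : PBond P k => (HaarData.haar : Measure G))) V < ∞ :=
    ae_lt_top hLm hfin
  rw [integral_eq_lintegral_of_nonneg_ae (Filter.Eventually.of_forall h0') hm'.aestronglyMeasurable, ← hlin,
    ← integral_toReal hLm.aemeasurable hlt]
  rfl

variable {R : Type} [Fintype R]

/-- The (0.3)-quotient `∫dVρ(Z,·) ∕ ∫dVρ(Z″,·)` of the knit datum is NONNEGATIVE for integrable a.e.-non-negative pieces. [cite: Balaban1989LargeFieldI, (0.3) p.176 (bookkeeping)] -/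
theorem quot03_knit_nonneg_int (piece : R → Density P k G) (pp : R → R) (fib : R → Finset (PBond P k))
    (hi : ∀ Z, Integrable (piece Z) (fieldMeasure P k G)) (h0 : ∀ Z, ∀ᵐ V ∂(fieldMeasure P k G), 0 ≤ piece Z V) (Z : R) :
    0 ≤ quot03 (knitRData piece pp fib) Z := by
  show 0 ≤ (∫ V, fibreIntegral (fib Z) (piece Z) V ∂(fieldMeasure P k G)) / ∫ V, fibreIntegral (fib Z) (piece (pp Z)) V ∂(fieldMeasure P k G)
  rw [integral_fibreIntegral_int (fib Z) (hi Z) (h0 Z), integral_fibreIntegral_int (fib Z) (hi _) (h0 _)]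
  exact div_nonneg (integral_nonneg_of_ae (h0 Z)) (integral_nonneg_of_ae (h0 _))

/-- … and POSITIVE when the piece `Z` and its denominator piece `Z″ = pp Z` both have positive mass. [cite: Balaban1989LargeFieldI, (0.3) p.176, p.176 ll.14–16] -/
theorem quot03_knit_pos_int (piece : R → Density P k G) (pp : R → R) (fib : R → Finset (PBond P k))
    (hi : ∀ Z, Integrable (piece Z) (fieldMeasure P k G)) (h0 : ∀ Z, ∀ᵐ V ∂(fieldMeasure P k G), 0 ≤ piece Z V) {Z : R}
    (hZ : 0 < ∫ V, piece Z V ∂(fieldMeasure P k G)) (hppZ : 0 < ∫ V, piece (pp Z) V ∂(fieldMeasure P k G)) :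
    0 < quot03 (knitRData piece pp fib) Z := by
  show 0 < (∫ V, fibreIntegral (fib Z) (piece Z) V ∂(fieldMeasure P k G)) / ∫ V, fibreIntegral (fib Z) (piece (pp Z)) V ∂(fieldMeasure P k G)
  rw [integral_fibreIntegral_int (fib Z) (hi Z) (h0 Z), integral_fibreIntegral_int (fib Z) (hi _) (h0 _)]
  exact div_pos hZ hppZ

open Classical in
/-- **THE (0.5)-SUM OF AN OCCURRING REGION IS POSITIVE, integrable currency**: every denominator piece `ρ(Z″,·)` of positive mass and the region `W` selected by SOME
positive-mass piece (dag-n12-e's `quotSum_knit_pos_of_massSel` with `hm ∕ h0 ∕ hC` weakened to integrable ∧ a.e. `≥ 0`). [cite: Balaban1989LargeFieldI, (0.5) p.176, p.176 ll.14–16] -/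
theorem quotSum_knit_pos_of_massSel_int (piece : R → Density P k G) (pp : R → R) (fib : R → Finset (PBond P k))
    (hi : ∀ Z, Integrable (piece Z) (fieldMeasure P k G)) (h0 : ∀ Z, ∀ᵐ V ∂(fieldMeasure P k G), 0 ≤ piece Z V)
    (hmassSel : ∀ Z, 0 < ∫ V, piece (pp Z) V ∂(fieldMeasure P k G))
    {W : R} (hW : ∃ Z, pp Z = W ∧ 0 < ∫ V, piece Z V ∂(fieldMeasure P k G)) :
    0 < quotSum (knitRData piece pp fib) W := by
  obtain ⟨Z₀, hZ₀, hm₀⟩ := hW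
  unfold quotSum
  refine Finset.sum_pos' (fun Z _ => quot03_knit_nonneg_int piece pp fib hi h0 Z) ⟨Z₀, ?_, ?_⟩
  · exact Finset.mem_filter.2 ⟨Finset.mem_univ _, hZ₀⟩
  · exact quot03_knit_pos_int piece pp fib hi h0 hm₀ (hmassSel Z₀)

/-- **(0.4) FOR THE KNIT DATUM, integrable currency** — `∫dV (𝐑ρ)(V) = ∫dV Σ_Z ρ(Z,V)` in the cell's scalar reading of `∫dV⌈_{Z′}` (`RData.IntOver` a number): term by term
`∫dV ρ(Z″,·)·(∫dVρ(Z,·) ∕ ∫dVρ(Z″,·)) = ∫dVρ(Z,·)`, the restricted integrals turned into masses by `integral_fibreIntegral_int` (n12-a's `normalization04_knit_of_mass` with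
`hm ∕ h0 ∕ hC` weakened to integrable ∧ a.e. `≥ 0`). [cite: Balaban1989LargeFieldI, (0.4) p.176, p.176 ll.14–16] -/
theorem normalization04_knit_int (piece : R → Density P k G) (pp : R → R) (fib : R → Finset (PBond P k))
    (hi : ∀ Z, Integrable (piece Z) (fieldMeasure P k G)) (h0 : ∀ Z, ∀ᵐ V ∂(fieldMeasure P k G), 0 ≤ piece Z V)
    (hmassSel : ∀ Z, 0 < ∫ V, piece (pp Z) V ∂(fieldMeasure P k G)) :
    Normalization04 (knitRData piece pp fib) := by
  have ha : ∀ Z, (∫ V, fibreIntegral (fib Z) (piece Z) V ∂(fieldMeasure P k G)) = ∫ V, piece Z V ∂(fieldMeasure P k G) :=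
    fun Z => integral_fibreIntegral_int (fib Z) (hi Z) (h0 Z)
  have hb : ∀ Z, (∫ V, fibreIntegral (fib Z) (piece (pp Z)) V ∂(fieldMeasure P k G)) = ∫ V, piece (pp Z) V ∂(fieldMeasure P k G) :=
    fun Z => integral_fibreIntegral_int (fib Z) (hi _) (h0 _)
  show (∫ V, Rop (knitRData piece pp fib) V ∂(fieldMeasure P k G)) = ∫ V, (∑ Z, piece Z V) ∂(fieldMeasure P k G)
  have hterm : ∀ Z, Integrable (fun V => piece (pp Z) V *
      ((∫ U, fibreIntegral (fib Z) (piece Z) U ∂(fieldMeasure P k G)) /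
        (∫ U, fibreIntegral (fib Z) (piece (pp Z)) U ∂(fieldMeasure P k G)))) (fieldMeasure P k G) :=
    fun Z => (hi (pp Z)).mul_const _
  simp only [Rop, knitRData, id]
  rw [integral_finsetSum _ (fun Z _ => hterm Z), integral_finsetSum _ (fun Z _ => hi Z)]
  refine Finset.sum_congr rfl (fun Z _ => ?_)
  have hB : (∫ V, piece (pp Z) V ∂(fieldMeasure P k G)) ≠ 0 := (hmassSel Z).ne'
  rw [integral_mul_const, ha Z, hb Z]
  calc (∫ V, piece (pp Z) V ∂(fieldMeasure P k G)) * ((∫ V, piece Z V ∂(fieldMeasure P k G)) / ∫ V, piece (pp Z) V ∂(fieldMeasure P k G))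
      = (∫ V, piece Z V ∂(fieldMeasure P k G)) *
          ((∫ V, piece (pp Z) V ∂(fieldMeasure P k G)) / ∫ V, piece (pp Z) V ∂(fieldMeasure P k G)) := by ring
    _ = ∫ V, piece Z V ∂(fieldMeasure P k G) := by rw [div_self hB, mul_one]

variable [DecidableEq R] {P₀ : Params} {C ι : Type} (κ : KnitData P k G R P₀ C ι)

/-- **(0.5) on the occurring regions HOLDS for the `log`-pinned exponents, integrable currency, on the denominator-mass proviso with a fibre witness** (`exp (log q) = q`,
`q > 0` by `quotSum_knit_pos_of_massSel_int`). [cite: Balaban1989LargeFieldI, (0.5) p.176] -/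
theorem hyp05Image_logExp_of_massSel_int (hi : ∀ Z, Integrable (κ.piece Z) (fieldMeasure P k G))
    (h0 : ∀ Z, ∀ᵐ V ∂(fieldMeasure P k G), 0 ≤ κ.piece Z V) (hmassSel : ∀ Z, 0 < ∫ V, κ.piece (κ.pp Z) V ∂(fieldMeasure P k G))
    (hfib : ∀ Z, ∃ Z', κ.pp Z' = κ.pp Z ∧ 0 < ∫ V, κ.piece Z' V ∂(fieldMeasure P k G)) :
    ∀ W ∈ Finset.univ.image κ.logExp.pp, quotSum κ.logExp.rdata W = Real.exp (κ.logExp.Rexp W) := by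
  intro W hW
  obtain ⟨Z, _, hZ⟩ := Finset.mem_image.1 hW
  obtain ⟨Z', hZ', hmZ'⟩ := hfib Z
  exact (Real.exp_log (quotSum_knit_pos_of_massSel_int κ.piece κ.pp κ.fib hi h0 hmassSel ⟨Z', hZ'.trans hZ, hmZ'⟩)).symm

/-- **THE B15 LEAF AT `knitW15 κ.logExp`, INTEGRABLE CURRENCY, ON THE DENOMINATOR-MASS PROVISO**: pieces integrable and a.e. `≥ 0`, denominators of positive mass, a fibre
witness per denominator; (0.4) by `normalization04_knit_int`, (0.6) from (0.5) on the occurring regions (`B15LeafKnit.expForm06_of_hyp05_image`); DISPLAYED exactly Proposition 1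
(1.78), (1.80) on the ℍ-domains, (1.89), (1.102) (dag-n12-e's `b15Leaf_knit_logExp_of_massSel` with `hm ∕ h0 ∕ hC` weakened). [cite: Balaban1989LargeFieldI, (0.4)–(0.6) p.176, Prop. 1 (1.78) p.194, (1.80) p.195, (1.89) p.198, (1.102) p.201] -/
theorem b15Leaf_knit_logExp_of_massSel_int (hi : ∀ Z, Integrable (κ.piece Z) (fieldMeasure P k G))
    (h0 : ∀ Z, ∀ᵐ V ∂(fieldMeasure P k G), 0 ≤ κ.piece Z V) (hmassSel : ∀ Z, 0 < ∫ V, κ.piece (κ.pp Z) V ∂(fieldMeasure P k G))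
    (hfib : ∀ Z, ∃ Z', κ.pp Z' = κ.pp Z ∧ 0 < ∫ V, κ.piece Z' V ∂(fieldMeasure P k G))
    (hP1 : Prop1Printed κ.LF)
    (h180 : ∀ U, new189 κ.D189 U → ∀ i, κ.D189.h ≤ i → i ≤ κ.D189.k → ∀ p ∈ plaqsOf (dom κ.D189 i),
      Ineq180 (κ.D189.dev0 U p) (κ.D189.ε κ.D189.k) κ.D189.η κ.D189.B₃ κ.D189.B₅ κ.D189.M κ.D189.δ (κ.D189.dist p) κ.D189.O1)
    (h189 : Claim189 (new189 κ.D189) (chiPP κ.D189)) (h1102 : Normalization1102 κ.D1100 κ.ρk) :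
    B15Leaf (knitW15 κ.logExp) where
  n04 := normalization04_knit_int κ.piece κ.pp κ.fib hi h0 hmassSel
  e06 := B15LeafKnit.expForm06_of_hyp05_image κ.logExp.rdata κ.logExp.Rexp (hyp05Image_logExp_of_massSel_int κ hi h0 hmassSel hfib)
  p1 := hP1
  i180 := (B15LeafKnit.i180_knit_iff κ.logExp).2 h180
  c189 := h189
  e1102 := h1102

end Generic

/-! ### §1b At the 𝐑-step of a (2.18) representation `r` with selector `sel` and fibre bonds `fib` (the pin `WOfRepr r sel fib LF D189 D1100`) -/

section Repr

variable {P : Params} {G : Type} [GaugeGroup G] [MeasurableSpace G] [HaarData G]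
variable {j : ℕ} [DecidableEq (PBond P j)] {P₀ : Params} {C ι : Type}
  (r : Step.Repr218 P G j) (sel : r.Adm → r.Adm) (fib : r.Adm → Finset (PBond P j))
  (LF : B15.LFVar) (D189 : Setting189 P₀ G C ι) (D1100 : RPrimeData P j G)

/-- **THE B15 LEAF AT THE PIN `WOfRepr r sel fib LF D189 D1100`, INTEGRABLE CURRENCY**: the terms `t_a` integrable and a.e. `≥ 0`, the DENOMINATOR terms `t_{sel a}` of positive mass,
a fibre witness per denominator, and EXACTLY Proposition 1 (1.78), (1.80), (1.89), (1.102) at `ρ = Σ_a t_a` (dag-n12-e's `b15Leaf_WOfRepr_of_massSel`, weakened).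
[cite: Balaban1989LargeFieldI, (0.2)–(0.6) p.176, p.176 ll.14–16, Prop. 1 (1.78) p.194, (1.80) p.195, (1.89) p.198, (1.102) p.201; Balaban1988Convergent, (2.18) p.257] -/
theorem b15Leaf_WOfRepr_of_massSel_int (hi : ∀ a, Integrable (rterm r a) (fieldMeasure P j G))
    (h0 : ∀ a, ∀ᵐ V ∂(fieldMeasure P j G), 0 ≤ rterm r a V) (hmassSel : ∀ a, 0 < ∫ V, rterm r (sel a) V ∂(fieldMeasure P j G))
    (hfib : ∀ a, ∃ a', sel a' = sel a ∧ 0 < ∫ V, rterm r a' V ∂(fieldMeasure P j G)) (hP1 : Prop1Printed LF)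
    (h180 : ∀ U, new189 D189 U → ∀ i, D189.h ≤ i → i ≤ D189.k → ∀ p ∈ plaqsOf (dom D189 i),
      Ineq180 (D189.dev0 U p) (D189.ε D189.k) D189.η D189.B₃ D189.B₅ D189.M D189.δ (D189.dist p) D189.O1)
    (h189 : Claim189 (new189 D189) (chiPP D189)) (h1102 : Normalization1102 D1100 (fun V => ∑ a, rterm r a V)) :
    B15Leaf (WOfRepr r sel fib LF D189 D1100) := by
  letI := Classical.decEq r.Adm
  exact b15Leaf_knit_logExp_of_massSel_int (knitOfRepr r sel fib LF D189 D1100) hi h0 hmassSel hfib hP1 h180 h189 h1102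

/-- **(1.102) AT THE 𝐑-STEP'S OWN (1.100)-READING, INTEGRABLE CURRENCY**: under def-R's `(repDataOfSel r sel fib).ProvisosInt`, `Normalization1102 (rPrimeDataOfSel r sel fib) (Σ_a t_a)` —
dag-n12-e's `rPrime1100_rPrimeDataOfSel` (𝐑′ of record read at the 𝐑-step IS the 𝐑-step) and def-R's `integral_ropReal_eq_int` ((0.4) with NO uniform bound)
(dag-n12-e's `normalization1102_rPrimeDataOfSel_supp`, weakened). [cite: Balaban1989LargeFieldI, (1.100)–(1.102) p.201, (0.4) p.176] -/
theorem normalization1102_rPrimeDataOfSel_int (hint : (repDataOfSel r sel fib).ProvisosInt) :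
    Normalization1102 (rPrimeDataOfSel r sel fib) (fun V => ∑ a, rterm r a V) := by
  obtain ⟨hi, h0, hsupp⟩ := (provisosInt_repDataOfSel_iff r sel fib).1 hint
  show (∫ V, rPrime1100 (rPrimeDataOfSel r sel fib) V ∂(fieldMeasure P j G)) = ∫ V, (∑ a, rterm r a V) ∂(fieldMeasure P j G)
  rw [rPrime1100_rPrimeDataOfSel]
  exact integral_ropReal_eq_int (rterm r) sel fib hi h0 hsupp

/-- **★ THE B15 LEAF AT THE PIN FROM def-R's INTEGRABLE PROVISOS AND THE (1.100) PIN EQUATION**: `(repDataOfSel r sel fib).ProvisosInt` (the record's own `rstep` text) supplies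
`hi ∕ h0` AND (1.102) once the layer's 𝐑′-data are the 𝐑-step's reading (`hpin : D1100 = rPrimeDataOfSel r sel fib`); displayed: the denominator masses, the fibre witness,
and EXACTLY Proposition 1 (1.78), (1.80), (1.89). [cite: Balaban1989LargeFieldI, (0.2)–(0.6) p.176, p.176 ll.14–16, Prop. 1 (1.78) p.194, (1.80) p.195, (1.89) p.198, (1.99)–(1.102) pp.200–201] -/
theorem b15Leaf_WOfRepr_of_provisosInt_massSel (hint : (repDataOfSel r sel fib).ProvisosInt) (hpin : D1100 = rPrimeDataOfSel r sel fib)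
    (hmassSel : ∀ a, 0 < ∫ V, rterm r (sel a) V ∂(fieldMeasure P j G))
    (hfib : ∀ a, ∃ a', sel a' = sel a ∧ 0 < ∫ V, rterm r a' V ∂(fieldMeasure P j G)) (hP1 : Prop1Printed LF)
    (h180 : ∀ U, new189 D189 U → ∀ i, D189.h ≤ i → i ≤ D189.k → ∀ p ∈ plaqsOf (dom D189 i),
      Ineq180 (D189.dev0 U p) (D189.ε D189.k) D189.η D189.B₃ D189.B₅ D189.M D189.δ (D189.dist p) D189.O1)
    (h189 : Claim189 (new189 D189) (chiPP D189)) : B15Leaf (WOfRepr r sel fib LF D189 D1100) := by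
  obtain ⟨hi, h0, -⟩ := (provisosInt_repDataOfSel_iff r sel fib).1 hint
  refine b15Leaf_WOfRepr_of_massSel_int r sel fib LF D189 D1100 hi h0 hmassSel hfib hP1 h180 h189 ?_
  rw [hpin]
  exact normalization1102_rPrimeDataOfSel_int r sel fib hint

end Repr

/-! ## §2 AT NODE 00's STAGE-13 BUNDLE OF RECORD `WOfRecord₁₃ θ λ P` (n10-d `Node00/Record13Carriers`; def-T `Node00/Record13` v1.1) -/

section Record13

variable {F : T4Family} {N : ℕ} [NeZero N] (θ : Stage13Params F N) (lam : ResidW F N)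

/-- **def-T's `Provisos₁₃.rstep P k` IS def-R's INTEGRABLE-form provisos of the N12 knit datum at `Tstep rep_k` of record, Stage 13** — regions := the sequences of record at
level `k+1` along `gOfRecord₁₃ θ P`, pieces := the pre-𝐑 terms `t_s = χ_{k+1}(s)·(𝐓e^A)_{k+1}(s)` of `reprTOfRecord₁₃ θ P k`, `Z ↦ Z″ := θ.ppSel P _ (k+1)`, fresh variables
`fibOfSeq … (k+1)` — by def-R's `rfl` bridge `toRepData_towerRepOfRecord_eq` (instance-generic). [cite: Balaban1989LargeFieldI, (0.3) p.176; Balaban1988Convergent, (3.25) p.270 (bookkeeping)] -/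
theorem provisosInt_reprTOfRecord₁₃_of_provisos₁₃ (hP : θ.Provisos₁₃ F N) (P : B12.RunParams) (k : ℕ) [DecidableEq (PBond (F.P P.K) (k + 1))] (hk : k < P.K) :
    (repDataOfSel (reprTOfRecord₁₃ F N θ P k) (θ.ppSel P (gOfRecord₁₃ F N θ P) (k + 1))
      (fibOfSeq F θ.ν θ.τ9 P (gOfRecord₁₃ F N θ P) (k + 1))).ProvisosInt := by
  have h := hP.rstep P k hk
  rw [toRepData_towerRepOfRecord_eq] at h
  exact h

/-- **(1.102) FOR `𝐓ρ_k` OF RECORD, Stage 13, at the 𝐑-step's (1.100)-reading, FROM `Provisos₁₃` ALONE** (`k < K`): §1b's `normalization1102_rPrimeDataOfSel_int` fed by `rstep`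
(the ₁₃ twin of dag-n12-e's `normalization1102_trhoOfRecord9_of_provisos₁₀`; `Σ_s t_s = tdensOfRecord₁₃ θ P k` is `rfl`). [cite: Balaban1989LargeFieldI, (1.102) p.201, (0.4) p.176; Balaban1988Convergent, (3.25) p.270] -/
theorem normalization1102_reprTOfRecord₁₃_of_provisos₁₃ (hP : θ.Provisos₁₃ F N) (P : B12.RunParams) (k : ℕ) [DecidableEq (PBond (F.P P.K) (k + 1))]
    (hk : k < P.K) :
    Normalization1102
      (rPrimeDataOfSel (reprTOfRecord₁₃ F N θ P k) (θ.ppSel P (gOfRecord₁₃ F N θ P) (k + 1)) (fibOfSeq F θ.ν θ.τ9 P (gOfRecord₁₃ F N θ P) (k + 1)))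
      (tdensOfRecord₁₃ F N θ P k) :=
  normalization1102_rPrimeDataOfSel_int _ _ _ (provisosInt_reprTOfRecord₁₃_of_provisos₁₃ θ hP P k hk)

/-- **THE [IV] LEAF AT THE STAGE-13 BUNDLE OF RECORD, ANY RUN, FROM THE INTEGRABLE PROVISOS OF THE KNIT DATUM** (displayed — below the torus they are the record's `rstep`,
`b15Leaf_WOfRecord₁₃_of_massSel`; the degenerate-run form): with the (1.100) PIN EQUATION `hpin` on the layer's 𝐑′-data at the ₁₃ tower, the denominator-mass display, the
fibre witness, and EXACTLY Proposition 1 (1.78) on `λ.LF P`, (1.80) ∕ (1.89) on `λ.D189 P` — the ₁₃ twin of dag-n12-e's `b15Leaf_WOfRecord₁₀_of_massSel_supp` in the Int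
currency. [cite: Balaban1989LargeFieldI, (0.2)–(0.6) p.176, p.176 ll.14–16, Prop. 1 (1.78) p.194, (1.80) p.195, (1.89) p.198, (1.99)–(1.102) pp.200–201] -/
theorem b15Leaf_WOfRecord₁₃_of_provisosInt_massSel {P : B12.RunParams}
    (hint : (repDataOfSel (reprTOfRecord₁₃ F N θ P (lam.kSel P)) (θ.ppSel P (gOfRecord₁₃ F N θ P) (lam.kSel P + 1))
      (fibOfSeq F θ.ν θ.τ9 P (gOfRecord₁₃ F N θ P) (lam.kSel P + 1))).ProvisosInt)
    (hpin : lam.D1100 P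
      = rPrimeDataOfSel (reprTOfRecord₁₃ F N θ P (lam.kSel P)) (θ.ppSel P (gOfRecord₁₃ F N θ P) (lam.kSel P + 1))
          (fibOfSeq F θ.ν θ.τ9 P (gOfRecord₁₃ F N θ P) (lam.kSel P + 1)))
    (hmassSel : ∀ s, 0 < ∫ V, rterm (reprTOfRecord₁₃ F N θ P (lam.kSel P)) (θ.ppSel P (gOfRecord₁₃ F N θ P) (lam.kSel P + 1) s) V
      ∂(fieldMeasure (F.P P.K) (lam.kSel P + 1) (SU N)))
    (hfib : ∀ s, ∃ s', θ.ppSel P (gOfRecord₁₃ F N θ P) (lam.kSel P + 1) s' = θ.ppSel P (gOfRecord₁₃ F N θ P) (lam.kSel P + 1) s ∧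
      0 < ∫ V, rterm (reprTOfRecord₁₃ F N θ P (lam.kSel P)) s' V ∂(fieldMeasure (F.P P.K) (lam.kSel P + 1) (SU N)))
    (hP1 : Prop1Printed (lam.LF P))
    (h180 : ∀ U, new189 (lam.D189 P) U → ∀ i, (lam.D189 P).h ≤ i → i ≤ (lam.D189 P).k → ∀ q ∈ plaqsOf (dom (lam.D189 P) i),
      Ineq180 ((lam.D189 P).dev0 U q) ((lam.D189 P).ε (lam.D189 P).k) (lam.D189 P).η (lam.D189 P).B₃ (lam.D189 P).B₅ (lam.D189 P).M (lam.D189 P).δ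
        ((lam.D189 P).dist q) (lam.D189 P).O1)
    (h189 : Claim189 (new189 (lam.D189 P)) (chiPP (lam.D189 P))) : B15Leaf (WOfRecord₁₃ F N θ lam P) :=
  b15Leaf_WOfRepr_of_provisosInt_massSel _ _ _ (lam.LF P) (lam.D189 P) (lam.D1100 P) hint hpin hmassSel hfib hP1 h180 h189

/-- **★★ THE [IV] LEAF AT THE STAGE-13 BUNDLE OF RECORD FROM `Provisos₁₃`** (`kSel P < P.K`): def-T's `Provisos₁₃.rstep` (integrable form) supplies the knit datum's provisos AND
(1.102) at the pin; displayed: the (1.100) pin equation at the ₁₃ tower, the denominator masses, the fibre witness, and EXACTLY Proposition 1 (1.78), (1.80), (1.89) —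
the ₁₃ twin of dag-n12-e's `b15Leaf_WOfRecord₁₀_of_massSel`. [cite: Balaban1989LargeFieldI, (0.2)–(0.6) p.176, p.176 ll.14–16, Prop. 1 (1.78) p.194, (1.80) p.195, (1.89) p.198, (1.99)–(1.102) pp.200–201; Balaban1988Convergent, (3.25) p.270] -/
theorem b15Leaf_WOfRecord₁₃_of_massSel (hP : θ.Provisos₁₃ F N) {P : B12.RunParams} (hk : lam.kSel P < P.K)
    (hpin : lam.D1100 P
      = rPrimeDataOfSel (reprTOfRecord₁₃ F N θ P (lam.kSel P)) (θ.ppSel P (gOfRecord₁₃ F N θ P) (lam.kSel P + 1))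
          (fibOfSeq F θ.ν θ.τ9 P (gOfRecord₁₃ F N θ P) (lam.kSel P + 1)))
    (hmassSel : ∀ s, 0 < ∫ V, rterm (reprTOfRecord₁₃ F N θ P (lam.kSel P)) (θ.ppSel P (gOfRecord₁₃ F N θ P) (lam.kSel P + 1) s) V
      ∂(fieldMeasure (F.P P.K) (lam.kSel P + 1) (SU N)))
    (hfib : ∀ s, ∃ s', θ.ppSel P (gOfRecord₁₃ F N θ P) (lam.kSel P + 1) s' = θ.ppSel P (gOfRecord₁₃ F N θ P) (lam.kSel P + 1) s ∧
      0 < ∫ V, rterm (reprTOfRecord₁₃ F N θ P (lam.kSel P)) s' V ∂(fieldMeasure (F.P P.K) (lam.kSel P + 1) (SU N)))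
    (hP1 : Prop1Printed (lam.LF P))
    (h180 : ∀ U, new189 (lam.D189 P) U → ∀ i, (lam.D189 P).h ≤ i → i ≤ (lam.D189 P).k → ∀ q ∈ plaqsOf (dom (lam.D189 P) i),
      Ineq180 ((lam.D189 P).dev0 U q) ((lam.D189 P).ε (lam.D189 P).k) (lam.D189 P).η (lam.D189 P).B₃ (lam.D189 P).B₅ (lam.D189 P).M (lam.D189 P).δ
        ((lam.D189 P).dist q) (lam.D189 P).O1)
    (h189 : Claim189 (new189 (lam.D189 P)) (chiPP (lam.D189 P))) : B15Leaf (WOfRecord₁₃ F N θ lam P) :=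
  b15Leaf_WOfRecord₁₃_of_provisosInt_massSel θ lam (provisosInt_reprTOfRecord₁₃_of_provisos₁₃ θ hP P (lam.kSel P) hk)
    hpin hmassSel hfib hP1 h180 h189

/-- **THE `rBasicStep` LEAF OF n10-d's FOUR-PIN STAGE-13 VIEW `θ.view₁₃B10YZW Mstar ops ζ λ`** at run `P` from the same displays (his `upOfRecord₅C_view₁₃B10YZW_leaves`, first
conjunct, is the `Iff` with `B15Leaf (WOfRecord₁₃ θ λ P)`). [cite: Balaban1989LargeFieldI, (0.2)–(0.6) p.176, Prop. 1 (1.78) p.194, (1.80) p.195, (1.89) p.198, (1.99)–(1.102) pp.200–201; Balaban1989LargeFieldII, Thm 1 + (0.1) pp.355–356] -/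
theorem rBasicStep_view₁₃B10YZW_of_massSel (hP : θ.Provisos₁₃ F N) (Mstar : ℕ) (ops : OpsY N θ.toStage3Params Mstar) (ζ : ResidZ F N)
    {P : B12.RunParams} (hk : lam.kSel P < P.K)
    (hpin : lam.D1100 P
      = rPrimeDataOfSel (reprTOfRecord₁₃ F N θ P (lam.kSel P)) (θ.ppSel P (gOfRecord₁₃ F N θ P) (lam.kSel P + 1))
          (fibOfSeq F θ.ν θ.τ9 P (gOfRecord₁₃ F N θ P) (lam.kSel P + 1)))
    (hmassSel : ∀ s, 0 < ∫ V, rterm (reprTOfRecord₁₃ F N θ P (lam.kSel P)) (θ.ppSel P (gOfRecord₁₃ F N θ P) (lam.kSel P + 1) s) V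
      ∂(fieldMeasure (F.P P.K) (lam.kSel P + 1) (SU N)))
    (hfib : ∀ s, ∃ s', θ.ppSel P (gOfRecord₁₃ F N θ P) (lam.kSel P + 1) s' = θ.ppSel P (gOfRecord₁₃ F N θ P) (lam.kSel P + 1) s ∧
      0 < ∫ V, rterm (reprTOfRecord₁₃ F N θ P (lam.kSel P)) s' V ∂(fieldMeasure (F.P P.K) (lam.kSel P + 1) (SU N)))
    (hP1 : Prop1Printed (lam.LF P))
    (h180 : ∀ U, new189 (lam.D189 P) U → ∀ i, (lam.D189 P).h ≤ i → i ≤ (lam.D189 P).k → ∀ q ∈ plaqsOf (dom (lam.D189 P) i),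
      Ineq180 ((lam.D189 P).dev0 U q) ((lam.D189 P).ε (lam.D189 P).k) (lam.D189 P).η (lam.D189 P).B₃ (lam.D189 P).B₅ (lam.D189 P).M (lam.D189 P).δ
        ((lam.D189 P).dist q) (lam.D189 P).O1)
    (h189 : Claim189 (new189 (lam.D189 P)) (chiPP (lam.D189 P))) :
    (upOfRecord₅C F N (θ.view₁₃B10YZW F N Mstar ops ζ lam) P).rBasicStep :=
  (upOfRecord₅C_view₁₃B10YZW_leaves F N θ Mstar ops ζ lam P).1.2
    (b15Leaf_WOfRecord₁₃_of_massSel θ lam hP hk hpin hmassSel hfib hP1 h180 h189)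

end Record13

end Summit.QuantumFields.YangMills.BalabanUVNodes.N12LeafIntAtRecord13
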